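import Summits.ValiantsHypothesis.ValiantsHypothesis.Theorems.PerDivisionHard.Negative.PerLowDegreeRung
import Summits.ValiantsHypothesis.ValiantsHypothesis.Theorems.DivisionGapDefs
import Literature.Computability.AlgebraicComplexity.PermanentIrreducible

/-!
# Crux `DivisionGap.PerDivisionHard` (stmt-ValiantsHypothesis-5065), line
`pair-descent-jss-endpoint` — stub `stub_faceDescent` (the lever `FaceDescent`)

For a cell set `G ⊆ [n] × [n]`, a weight `w` cutting out the face `G` of the Birkhoff polytope
(`CutsOut w G`), a nonzero cofactor `h ∈ ℝ≥0[x_ij]` and an exponent vector `u` such that the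
top-`w` fibre of `h` has the single `G`-part `u` (`HasSingleGPart G w h u`):

  `L(x^u · per_G) ≤ L(per_n · h) + 1`,   `L = complexity` over the semiring `ℝ≥0`.

Proof (three free moves and one gate).
1. `top_w(per_n) = per_G` (`topComponent_perPoly_eq_facePer`): the `w`-weight of the permutation
   monomial `x^{μ_σ}` is `Σ_i w (σ i, i)`, the weighted degree of `per_n` is the maximal such
   weight, and `CutsOut` says that it is attained exactly by the permutations inside `G`.
2. Initial forms are free and multiplicative over `ℝ≥0` (`complexity_topComponent_le`,
   `topComponent_mul`): `L(per_G · top_w h) ≤ L(per_n · h)`.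
3. The projection `x_e ↦ x_e` (`e ∈ G`), `x_e ↦ 1` (`e ∉ G`) fixes `per_G` and maps `top_w h` to
   `a · x^u` with `a = Σ coeff (top_w h) ≠ 0` (single `G`-part; `h ≠ 0`); projections are free
   (`complexity_le_of_isProjection`): `L(per_G · a x^u) ≤ L(per_G · top_w h)`.
4. Unscale by `a⁻¹` at the cost of one gate (`complexity_smul_le_holds`).
-/

noncomputable section

-- `Summit.ValiantsHypothesis.ValiantsHypothesis.…` is the tree's mandated single-conjunct layout
-- (Sub = Summit), so the duplicated namespace component is intended.
set_option linter.dupNamespace false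

namespace Summit.ValiantsHypothesis.ValiantsHypothesis.Theorems.DivisionGapPerDivisionHard

open MvPolynomial Literature.Computability.AlgebraicComplexity
open Summit.ValiantsHypothesis.ValiantsHypothesis.Theorems.ZeroOneTransfer.Negative
open scoped NNReal

variable {n : ℕ}

/-! ### Step 1: the top component of the permanent in a direction cutting out `G` -/

/-- The `w`-weight of the permutation monomial `x^{μ_σ}` is `Σ_i w (σ i, i)`. [folklore] -/
private theorem weight_permMonomial (w : Fin n × Fin n → ℕ) (σ : Equiv.Perm (Fin n)) :
    Finsupp.weight w (permMonomial σ) = ∑ i, w (σ i, i) := by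
  rw [permMonomial, map_sum]
  refine Finset.sum_congr rfl fun i _ => ?_
  rw [Finsupp.weight_single, smul_eq_mul, one_mul]

/-- The weighted degree of `per_n` is the maximal weight of a permutation. [folklore] -/
private theorem weightedTotalDegree_perPoly (w : Fin n × Fin n → ℕ) :
    weightedTotalDegree w (perPoly (Fin n) ℝ≥0) =
      Finset.univ.sup fun σ : Equiv.Perm (Fin n) => ∑ i, w (σ i, i) := by
  rw [weightedTotalDegree, PerDivisionHard.Negative.support_perPoly_univ, Finset.sup_image]
  exact Finset.sup_congr rfl fun σ _ => weight_permMonomial w σ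

/-- The coefficients of the face permanent: `1` on the permutation monomials of the permutations
inside `G`, `0` elsewhere. [folklore] -/
private theorem coeff_permMonomial_facePer (G : Finset (Fin n × Fin n))
    (σ : Equiv.Perm (Fin n)) :
    coeff (permMonomial σ) (facePer G) = if ∀ i, (σ i, i) ∈ G then 1 else 0 := by
  classical
  unfold facePer
  rw [coeff_sum]
  simp only [coeff_monomial, permMonomial_injective.eq_iff]
  rw [Finset.sum_ite_eq']
  simp only [Finset.mem_filter, Finset.mem_univ, true_and]

/-- Off the permutation monomials the face permanent has coefficient `0`. [folklore] -/
private theorem coeff_facePer_eq_zero (G : Finset (Fin n × Fin n)) {d : (Fin n × Fin n) →₀ ℕ}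
    (hd : ∀ σ : Equiv.Perm (Fin n), permMonomial σ ≠ d) : coeff d (facePer G) = 0 := by
  classical
  unfold facePer
  rw [coeff_sum]
  exact Finset.sum_eq_zero fun σ _ => by rw [coeff_monomial, if_neg (hd σ)]

/-- **If `w` cuts out `G`, the top-`w` component of `per_n` is the face permanent `per_G`.**
[folklore] -/
theorem topComponent_perPoly_eq_facePer {G : Finset (Fin n × Fin n)} {w : Fin n × Fin n → ℕ}
    (hcut : CutsOut w G) : topComponent w (perPoly (Fin n) ℝ≥0) = facePer G := by
  classical
  refine MvPolynomial.ext _ _ fun d => ?_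
  rw [coeff_topComponent]
  by_cases hd : ∃ σ : Equiv.Perm (Fin n), permMonomial σ = d
  · obtain ⟨σ, rfl⟩ := hd
    rw [coeff_permMonomial_perPoly, coeff_permMonomial_facePer, weight_permMonomial,
      weightedTotalDegree_perPoly]
    have hiff : (∑ i, w (σ i, i)) = (Finset.univ.sup fun τ : Equiv.Perm (Fin n) =>
        ∑ i, w (τ i, i)) ↔ ∀ i, (σ i, i) ∈ G := by
      rw [hcut σ]
      constructor
      · intro h τ
        rw [h]
        exact Finset.le_sup (f := fun τ : Equiv.Perm (Fin n) => ∑ i, w (τ i, i))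
          (Finset.mem_univ τ)
      · intro h
        exact le_antisymm
          (Finset.le_sup (f := fun τ : Equiv.Perm (Fin n) => ∑ i, w (τ i, i))
            (Finset.mem_univ σ))
          (Finset.sup_le fun τ _ => h τ)
    by_cases hσ : ∀ i, (σ i, i) ∈ G
    · rw [if_pos (hiff.mpr hσ), if_pos hσ]
    · rw [if_neg (fun h => hσ (hiff.mp h)), if_neg hσ]
  · push Not at hd
    rw [coeff_facePer_eq_zero G hd]
    have h0 : coeff d (perPoly (Fin n) ℝ≥0) = 0 := by
      by_contra hne
      obtain ⟨ρ, hρ⟩ := exists_permMonomial_eq_of_coeff_perPoly_ne_zero ℝ≥0 hne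
      exact hd ρ hρ
    rw [h0, ite_self]

/-! ### Step 3: the projection keeping the cells of `G` -/

/-- The substitution keeping the variables of the cells of `G` and sending the others to `1`.
[folklore] -/
private def keepCells (G : Finset (Fin n × Fin n)) :
    Fin n × Fin n → MvPolynomial (Fin n × Fin n) ℝ≥0 :=
  fun e => if e ∈ G then X e else 1

/-- `keepCells` is a projection. [folklore] -/
private theorem isProjection_keepCells (G : Finset (Fin n × Fin n))
    (p : MvPolynomial (Fin n × Fin n) ℝ≥0) : IsProjection (aeval (keepCells G) p) p := by
  refine ⟨keepCells G, fun e => ?_, rfl⟩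
  by_cases he : e ∈ G
  · left; exact ⟨e, by simp [keepCells, he]⟩
  · right; exact ⟨1, by simp [keepCells, he]⟩

/-- `keepCells G` fixes the face permanent `per_G` (all its variables lie in `G`). [folklore] -/
private theorem aeval_keepCells_facePer (G : Finset (Fin n × Fin n)) :
    aeval (keepCells G) (facePer G) = facePer G := by
  unfold facePer
  rw [map_sum]
  refine Finset.sum_congr rfl fun σ hσ => ?_
  have hσG : ∀ i, (σ i, i) ∈ G := (Finset.mem_filter.mp hσ).2
  rw [show (monomial (permMonomial σ) (1 : ℝ≥0) : MvPolynomial _ ℝ≥0) = ∏ i, X (σ i, i) by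
    rw [permMonomial, monomial_sum_one]; rfl]
  rw [map_prod]
  refine Finset.prod_congr rfl fun i _ => ?_
  rw [aeval_X]
  exact if_pos (hσG i)

/-- Under `keepCells G`, a monomial agreeing with `u` on `G` (`u` supported inside `G`) becomes
`x^u`. [folklore] -/
private theorem prod_keepCells_eq_monomial (G : Finset (Fin n × Fin n))
    {u m : (Fin n × Fin n) →₀ ℕ} (huG : u.support ⊆ G) (hmu : ∀ e ∈ G, m e = u e) :
    (m.prod fun e k => keepCells G e ^ k) = monomial u 1 := by
  rw [Finsupp.prod]
  calc ∏ e ∈ m.support, keepCells G e ^ m e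
      = ∏ e ∈ m.support, (if e ∈ G then X e ^ u e else 1) := by
        refine Finset.prod_congr rfl fun e _ => ?_
        by_cases he : e ∈ G
        · simp only [keepCells, if_pos he, hmu e he]
        · simp only [keepCells, if_neg he, one_pow]
    _ = ∏ e ∈ m.support.filter (· ∈ G), X e ^ u e := (Finset.prod_filter _ _).symm
    _ = ∏ e ∈ u.support, X e ^ u e := by
        congr 1
        ext e
        simp only [Finset.mem_filter, Finsupp.mem_support_iff]
        constructor
        · rintro ⟨hme, he⟩
          rwa [← hmu e he]
        · intro hue
          have he : e ∈ G := huG (Finsupp.mem_support_iff.mpr hue)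
          exact ⟨by rwa [hmu e he], he⟩
    _ = monomial u 1 := prod_X_pow_eq_monomial

/-- Under `keepCells G`, a top fibre with the single `G`-part `u` becomes `a · x^u`, `a` the sum of
its coefficients. [folklore] -/
private theorem aeval_keepCells_topComponent {G : Finset (Fin n × Fin n)} {w : Fin n × Fin n → ℕ}
    {h : MvPolynomial (Fin n × Fin n) ℝ≥0} {u : (Fin n × Fin n) →₀ ℕ}
    (hu : HasSingleGPart G w h u) :
    aeval (keepCells G) (topComponent w h) =
      monomial u (∑ d ∈ (topComponent w h).support, coeff d (topComponent w h)) := by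
  conv_lhs => rw [(topComponent w h).as_sum]
  rw [map_sum, map_sum]
  refine Finset.sum_congr rfl fun d hd => ?_
  rw [aeval_monomial, prod_keepCells_eq_monomial G hu.1 (hu.2 d hd), ← C_eq_algebraMap,
    C_mul_monomial, mul_one]

/-! ### The lever -/

/-- **`stub_faceDescent` (the lever `FaceDescent` of line `pair-descent-jss-endpoint`).**  If `w`
cuts out `G`, `h ≠ 0`, and the top-`w` fibre of `h` has the single `G`-part `u`, then
`L(x^u · per_G) ≤ L(per_n · h) + 1` over `ℝ≥0`: `top_w(per_n · h) = per_G · top_w h` is free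
(`complexity_topComponent_le`, `topComponent_mul`, `topComponent_perPoly_eq_facePer`), the
projection `keepCells G` is free and leaves `per_G · a x^u` with `a ≠ 0`, and unscaling by `a⁻¹`
costs one gate (`complexity_smul_le_holds`). [folklore] -/
theorem stub_faceDescent :
    ∀ (n : ℕ) (G : Finset (Fin n × Fin n)) (w : Fin n × Fin n → ℕ)
      (h : MvPolynomial (Fin n × Fin n) ℝ≥0) (u : (Fin n × Fin n) →₀ ℕ),
      CutsOut w G → h ≠ 0 → HasSingleGPart G w h u →
      complexity (monomial u (1 : ℝ≥0) * facePer G) ≤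
        complexity (perPoly (Fin n) ℝ≥0 * h) + 1 := by
  intro n G w h u hcut hh hu
  set hs := topComponent w h with hhs
  have hne : hs ≠ 0 := topComponent_ne_zero _ hh
  -- (1)+(2) initial form
  have h1 : complexity (facePer G * hs) ≤ complexity (perPoly (Fin n) ℝ≥0 * h) := by
    have := complexity_topComponent_le w (perPoly (Fin n) ℝ≥0 * h)
    rwa [topComponent_mul, topComponent_perPoly_eq_facePer hcut] at this
  -- (3) projection
  set a : ℝ≥0 := ∑ d ∈ hs.support, coeff d hs with ha
  have ha0 : a ≠ 0 := sum_coeff_ne_zero hne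
  have h2 : complexity (facePer G * monomial u a) ≤ complexity (facePer G * hs) := by
    have := complexity_le_of_isProjection (isProjection_keepCells G (facePer G * hs))
    rwa [map_mul, aeval_keepCells_facePer, hhs, aeval_keepCells_topComponent hu] at this
  -- (4) unscale
  have h3 : complexity (monomial u (1 : ℝ≥0) * facePer G) ≤
      complexity (facePer G * monomial u a) + 1 := by
    have heq : monomial u (1 : ℝ≥0) * facePer G = a⁻¹ • (facePer G * monomial u a) := by
      rw [mul_comm, ← mul_smul_comm, smul_monomial, smul_eq_mul, inv_mul_cancel₀ ha0]
    rw [heq]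
    exact complexity_smul_le_holds _ _
  calc complexity (monomial u (1 : ℝ≥0) * facePer G)
      ≤ complexity (facePer G * monomial u a) + 1 := h3
    _ ≤ complexity (facePer G * hs) + 1 := Nat.succ_le_succ h2
    _ ≤ complexity (perPoly (Fin n) ℝ≥0 * h) + 1 := Nat.succ_le_succ h1

end Summit.ValiantsHypothesis.ValiantsHypothesis.Theorems.DivisionGapPerDivisionHard

end
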